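import Summits.QuantumFields.YangMills.Theorems.ConvexGribovBodyCovarianceBoundDefs
import Literature.MathematicalPhysics.QuantumFieldTheory.LatticeLangevinDynamics

/-!
# Route `ConvexGribovBody`, crux `CovarianceBound` (stmt-QuantumFields-8780): vocabulary of the line `Sketch`, part B
# (the `𝔤 / 𝔤^⊥` split of the gauge-fixed modes)

Second vocabulary file of the skeleton `Cruxes/CovarianceBound/Lines/Sketch.lean` (lead
`prover-line-stmt-QuantumFields-8780-0`), needed by its reshaped stubs after wave 1 showed that the support bound can
only hold for the `𝔤`-PROJECTION of the anti-Hermitian part of the gauge-fixed links (the `𝔤^⊥`-components — trace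
part for `SU(N ≥ 3)`, higher tensor harmonics for non-fundamental `ρ` — are invisible to every variation along `𝔤`;
worker findings and the standing disprover's `Cruxes/CovarianceBound/Disproof.lean` §B agree). `lieCosMode` /
`perpCosMode` are the two parts of the mid-link cosine mode `cosMode` under Shen–Zhu–Zhu's orthogonal projection
`LatticeRep.lieProj` (tree `LatticeLangevinDynamics.lean`), `supLieCosSq` / `supPerpCosSq` their sups over the Coulomb
minimisers, `lieCosComp` / `perpCosComp` the real components in a selected gauge; `LieAlgPerfect r` and
`CircleGeneratorsSpan r` are the two Lie-theoretic PREDICATES (Hall Thm 3.20/11.2, Sepanski Thm 5.2/5.18/5.21) that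
Zwanziger's support argument consumes — stated here, proved by the line's stubs `stub_lieAlgPerfect`,
`stub_circleGeneratorsSpan`. Nothing in this file is asserted; the only theorem is the registered glue identity
`cosMode_eq_lie_add_perp`.
-/

set_option autoImplicit false

noncomputable section

namespace Summit.QuantumFields.YangMills.Cruxes.CovarianceBound.SupportWindow

open scoped BigOperators Topology Manifold Classical MeasureTheory ProbabilityTheory Matrix InnerProductSpace ComplexConjugate ContinuousMap
open Filter Set Function TopologicalSpace MeasureTheory
open Literature.MathematicalPhysics.QuantumFieldTheory

variable {G : Type} [Group G] [TopologicalSpace G]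

/-- `𝔤`-part of the mid-link cosine mode: `P_𝔤 Ĉ_j(p) = Σ_y cos(…) P_𝔤 A_j(y)` (`LatticeRep.lieProj`, the
`Re tr(X Yᴴ)`-orthogonal projection onto `𝔤 = LatticeRep.lieAlg`). -/
def lieCosMode (r : LatticeRep G) (S : ℕ) (p : Fin 3 → ZMod (2 * S + 1)) (j : Fin 3)
    (U : GaugeConfig 4 (2 * S + 1) G) (h : Site 4 (2 * S + 1) → G) :
    Matrix (Fin r.N) (Fin r.N) ℂ :=
  r.lieProj (cosMode r S p j U h)

/-- `𝔤^⊥`-part of the mid-link cosine mode: `Ĉ_j(p) − P_𝔤 Ĉ_j(p)`. -/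
def perpCosMode (r : LatticeRep G) (S : ℕ) (p : Fin 3 → ZMod (2 * S + 1)) (j : Fin 3)
    (U : GaugeConfig 4 (2 * S + 1) G) (h : Site 4 (2 * S + 1) → G) :
    Matrix (Fin r.N) (Fin r.N) ℂ :=
  cosMode r S p j U h - r.lieProj (cosMode r S p j U h)

/-- `sup` over the minimisers of `‖P_𝔤 Ĉ_j(p)‖²_F`. -/
def supLieCosSq (r : LatticeRep G) (S : ℕ) (p : Fin 3 → ZMod (2 * S + 1)) (j : Fin 3)
    (U : GaugeConfig 4 (2 * S + 1) G) : ℝ :=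
  ⨆ h : {h : Site 4 (2 * S + 1) → G // IsCoulMin r S U h}, froSq (lieCosMode r S p j U h.1)

/-- `sup` over the minimisers of `‖Ĉ_j(p) − P_𝔤 Ĉ_j(p)‖²_F`. -/
def supPerpCosSq (r : LatticeRep G) (S : ℕ) (p : Fin 3 → ZMod (2 * S + 1)) (j : Fin 3)
    (U : GaugeConfig 4 (2 * S + 1) G) : ℝ :=
  ⨆ h : {h : Site 4 (2 * S + 1) → G // IsCoulMin r S U h}, froSq (perpCosMode r S p j U h.1)

/-- Real components of `P_𝔤 Ĉ_j(p)` in the gauge `sel U`. -/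
def lieCosComp (r : LatticeRep G) (S : ℕ) (p : Fin 3 → ZMod (2 * S + 1)) (j : Fin 3)
    (a b : Fin r.N) (q : Bool) (sel : GaugeConfig 4 (2 * S + 1) G → (Site 4 (2 * S + 1) → G))
    (U : GaugeConfig 4 (2 * S + 1) G) : ℝ :=
  bif q then (lieCosMode r S p j U (sel U) a b).re else (lieCosMode r S p j U (sel U) a b).im

/-- Real components of `Ĉ_j(p) − P_𝔤 Ĉ_j(p)` in the gauge `sel U`. -/
def perpCosComp (r : LatticeRep G) (S : ℕ) (p : Fin 3 → ZMod (2 * S + 1)) (j : Fin 3)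
    (a b : Fin r.N) (q : Bool) (sel : GaugeConfig 4 (2 * S + 1) G → (Site 4 (2 * S + 1) → G))
    (U : GaugeConfig 4 (2 * S + 1) G) : ℝ :=
  bif q then (perpCosMode r S p j U (sel U) a b).re else (perpCosMode r S p j U (sel U) a b).im

/-- (F1) `𝔤` is perfect: commutators of one-parameter generators span `𝔤` (true for `IsSimpleCompactGroup G`,
`G` compact: the centre of `𝔤` generates a closed connected central, hence normal, subgroup).
[cite: Sepanski2007, Thm. 5.18 and Thm. 5.21–5.22] [cite: Hall2015, Theorem 3.20] -/
def LieAlgPerfect (r : LatticeRep G) : Prop :=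
  Submodule.span ℝ {Z | ∃ X ∈ r.lieAlgCarrier, ∃ Y ∈ r.lieAlgCarrier, Z = X * Y - Y * X} = r.lieAlg

/-- (F3) `𝔤` is spanned by generators of CLOSED one-parameter subgroups (true for any compact `G`: the closure
of `exp(ℝX)` is a torus whose Lie algebra is spanned by its integer lattice `ker exp`).
[cite: Hall2015, Theorem 11.2 with Theorem 3.20] [cite: Sepanski2007, Thm. 5.2(a)] -/
def CircleGeneratorsSpan (r : LatticeRep G) : Prop :=
  Submodule.span ℝ {X | X ∈ r.lieAlgCarrier ∧ NormedSpace.exp X = (1 : Matrix (Fin r.N) (Fin r.N) ℂ)} =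
    r.lieAlg

/-- Glue identity (registered): the cosine mode is the sum of its `𝔤`- and `𝔤^⊥`-parts. -/
theorem cosMode_eq_lie_add_perp (r : LatticeRep G) (S : ℕ) (p : Fin 3 → ZMod (2 * S + 1)) (j : Fin 3)
    (U : GaugeConfig 4 (2 * S + 1) G) (h : Site 4 (2 * S + 1) → G) :
    cosMode r S p j U h = lieCosMode r S p j U h + perpCosMode r S p j U h := by
  unfold lieCosMode perpCosMode
  abel

end Summit.QuantumFields.YangMills.Cruxes.CovarianceBound.SupportWindow

end
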